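import Summits.CriticalPhenomena.PercolationContinuityZ3.Theorems.FK.MagnetizationPlateauLowerBound
import Summits.CriticalPhenomena.PercolationContinuityZ3.Theorems.FK.PressureFieldTrapezoidBounds
import Summits.CriticalPhenomena.PercolationContinuityZ3.Theorems.FK.FieldStrictMonotonicity
import HarnessLib

/-!
# THE LEVEL-1 LARGE-DEVIATION PRINCIPLE OF THE MAGNETISATION AT EVERY `(β, h)` AND EVERY BOUNDARY CONDITION: THE
# AFFINE (MAXWELL) PIECE OF THE RATE FUNCTION ON `[−m*, m*]` AT `h ≠ 0`, AND THE LOWER BOUND AT EVERY DENSITY WITH THE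
# LEGENDRE RATE ATTAINED (Ellis 2006 Thm. II.6.1 / §IV.5 / Thm. V.6.1; Lanford 1973; Föllmer–Orey 1988)

Claimed R42 (8)(c) in the cell INBOX at 2026-08-29T11:54:27Z by fkp-10a gen 360 (NEW CLAIM #1 of the gen), addressed to the lane under (ι) (coordinator fk-4 gen 295 CLOSED l.8907 11:26:11Z 2026-08-29; «(ι) RESUMES») and to the next seated fk-4 generation (ruling R182 requested); lineage row FO-10a-g360 (self-suggested), package g360-plateau, label PL-D.
Helper file of the `fk-continuity` build cell (bschramm lane; `--supports stmt-CriticalPhenomena-4575`; fkp-10a gen 360,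
package g360-plateau, label PL-D); builds on p205010 (kernel theorem, internal audit signed; external expert review
pending). No definitions, no named facts, no sorries; standard axioms.
UNCONDITIONAL (nearest-neighbour Ising model on `ℤ^d`, `d ≥ 1`, `β > 0`, every real field
`h`, boxes `Λ_N = {−N,…,N}^d`, EVERY boundary condition; `M_N = Σ_{x∈Λ_N} σ_x`, `ψ = pressure d β`, `m* = m*(β)`).
Scope: large-deviation lower bounds and Chernoff half-line upper bounds for `M_N/|Λ_N|` in finite volume; no
rate-function object / Varadhan form, no level-2/3 statement, no infinite-volume Gibbs state; nothing percolation-bearing.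

`MagnetizationPlateauLowerBound` reaches every density of the zero-field plateau `[−m*, m*]` at sub-volume-order cost.
Tilting from the field `h` to the field `0` (the tilting inequality `exp_mul_measureReal_window_le` of
`MagnetizationLargeDeviationsLower`) transports this to EVERY field: on `[−m*, m*]` the level-1 rate function of
`M_N/|Λ_N|` under `μ^{bc}_{Λ_N;β,h}` is the AFFINE function `I_{β,h}(a) = ψ(h) − ψ(0) − βha` (the Maxwell line; for
`β ≤ β_c` the segment is the single point `0`), positive for `h ≠ 0`, and the lower and upper large-deviation bounds
hold with exactly this rate. Together with the exposed densities `m* < |a| < 1` (the earlier files) this gives, at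
every `(β, h)` with `β > 0`, under EVERY boundary condition and at EVERY density `|a| < 1`, the large-deviation lower
bound with the Legendre rate `I_{β,h}(a) = max_u {βua − (ψ(h+u) − ψ(h))}` — the maximum being ATTAINED — and the
matching half-line upper bound.

* `eventually_exp_le_measureReal_window_of_exp_le` — lower bound at the field `h` from a SUB-EXPONENTIALLY massive
  window at the tilted field `h + s` (generalises `eventually_exp_le_measureReal_window`, which needed mass `≥ 1/2`);
* **`ld_lower_plateau_field`** — `|a| ≤ m*`, `δ, ε > 0`, every `h`, every `bc`: eventually
  `exp(−|Λ_N| (ψ(h) − ψ(0) − βha + |βh|δ + ε)) ≤ μ^{bc}_{Λ_N;β,h}{|M_N/|Λ_N| − a| < δ}`;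
* `ld_upper_plateau_of_nonneg_field` / `ld_upper_plateau_of_nonpos_field` — the matching Chernoff half-line bounds
  `μ{M_N ≤ a|Λ_N|} ≤ exp(−|Λ_N| (ψ(h) − ψ(0) − βha − ε))` (`h ≥ 0`), `μ{M_N ≥ a|Λ_N|} ≤ …` (`h ≤ 0`);
* `rate_field_le_affine_of_abs_le_spontaneousMagnetization`, `affine_rate_pos_of_field_ne_zero` — on the plateau the
  Legendre transform `sup_u {βua − (ψ(h+u) − ψ(h))}` EQUALS the affine function `ψ(h) − ψ(0) − βha` (attained at
  `u = −h`), which is `> 0` for `h ≠ 0` (trapezoid bound + strict monotonicity of `m(β,·)`);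
* **`exists_rate_attained_and_ld_bounds`** — THE LEVEL-1 LDP AT EVERY DENSITY: for `β > 0`, every `h`, every
  `|a| < 1`, `δ, ε > 0` and every `bc` there is a field increment `s` such that
  `I := βsa − (ψ(h+s) − ψ(h)) ≥ βua − (ψ(h+u) − ψ(h))` for all `u` (the Legendre supremum is attained at `s`),
  eventually `exp(−|Λ_N|(I + |βs|δ + ε)) ≤ μ^{bc}_{Λ_N;β,h}{|M_N/|Λ_N| − a| < δ}`, and the half-line beyond `a` on the
  side of `s` has probability `≤ exp(−|Λ_N|(I − ε))`; `ld_bounds_zero_field` is the case `h = 0`.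

## References

* R. S. Ellis, *Entropy, Large Deviations, and Statistical Mechanics*, Springer (2006), Thm. II.6.1, (2.28),
  §IV.5 (4.33)–(4.34), Thm. IV.6.6, Thm. V.6.1, Notes 11–13 to Ch. IV. [Ellis2006]
* O. E. Lanford, *Entropy and equilibrium states in classical statistical mechanics*, LNP 20 (1973), §A4, §B.
  [Lanford1973]
* H. Föllmer, S. Orey, Ann. Probab. 16 (1988) 961–977, Thm. 3.1 / §3. [FollmerOrey1988]
* S. Olla, PTRF 77 (1988), Thm. 5.2. [Olla1988]
* S. Friedli, Y. Velenik, *Statistical Mechanics of Lattice Systems*, CUP (2017), Thm. 3.6, Prop. 3.29, §4.7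
  (Maxwell construction). [FriedliVelenik2017]
-/

noncomputable section

namespace Summit.CriticalPhenomena.PercolationContinuityZ3.Theorems.FK

namespace IsingLargeDeviations

open MeasureTheory Filter Topology Finset Set
open Literature.Probability.LatticeModels

variable {d : ℕ}

/-! ### Lower bound at the field `h` from a sub-exponentially massive window at the tilted field `h + s` -/

/-- **LOWER BOUND FROM A SUB-EXPONENTIALLY MASSIVE WINDOW AT THE TILTED FIELD** (`d ≥ 1`): if eventually
`e^{−ε₁|Λ_N|} ≤ μ^{bc}_{Λ_N;β,h+s}{|M_N/|Λ_N| − a| < δ}`, then for every `ε > 0`, eventually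
`exp(−|Λ_N| (βsa − (ψ(β,h+s) − ψ(β,h)) + |βs|δ + ε₁ + ε)) ≤ μ^{bc}_{Λ_N;β,h}{|M_N/|Λ_N| − a| < δ}` (tilting inequality).
[cite: Ellis2006, Thm. II.6.1 (c) (proof, §VII.4) with §IV.5 eq. (4.33); Lanford1973, §B] -/
theorem eventually_exp_le_measureReal_window_of_exp_le (β h s : ℝ) (bc : BoundaryCondition (Site d))
    (a δ : ℝ) {ε₁ : ℝ}
    (hW : ∀ᶠ N : ℕ in atTop, Real.exp (-(ε₁ * #(box d N))) ≤
      (isingMeasure (zdGraph d) (box d N) β (h + s) bc).real {σ | |(∑ x ∈ box d N, spinAt x σ) / #(box d N) - a| < δ})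
    {ε : ℝ} (hε : 0 < ε) :
    ∀ᶠ N : ℕ in atTop,
      Real.exp (-(#(box d N) * (β * s * a - (pressure d β (h + s) - pressure d β h) + |β * s| * δ + ε₁ + ε))) ≤
        (isingMeasure (zdGraph d) (box d N) β h bc).real {σ | |(∑ x ∈ box d N, spinAt x σ) / #(box d N) - a| < δ} := by
  have hev1 : ∀ᶠ N : ℕ in atTop, pressure d β (h + s) - pressure d β h - ε <
      pressureIn (zdGraph d) (box d N) β (h + s) bc - pressureIn (zdGraph d) (box d N) β h bc :=
    (tendsto_pressureIn_sub (d := d) β h s bc).eventually (lt_mem_nhds (by linarith))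
  filter_upwards [hW, hev1] with N hN h1
  have hΛ := box_nonempty d N
  have hV : (0 : ℝ) < #(box d N) := by exact_mod_cast hΛ.card_pos
  have htilt := exp_mul_measureReal_window_le (zdGraph d) (box d N) β h s bc (a * #(box d N)) (δ * #(box d N))
  rw [← setOf_abs_div_sub_lt_eq hΛ, isingPartitionFunction_div_eq_exp_card_mul (zdGraph d) hΛ] at htilt
  refine le_trans ?_ htilt
  have hpos1 : 0 < Real.exp (-(β * s * (a * #(box d N))) - |β * s| * (δ * #(box d N))) *
      Real.exp (#(box d N) * (pressureIn (zdGraph d) (box d N) β (h + s) bc - pressureIn (zdGraph d) (box d N) β h bc)) :=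
    by positivity
  calc Real.exp (-(#(box d N) * (β * s * a - (pressure d β (h + s) - pressure d β h) + |β * s| * δ + ε₁ + ε)))
      = Real.exp (-(β * s * (a * #(box d N))) - |β * s| * (δ * #(box d N))) *
          Real.exp (#(box d N) * (pressure d β (h + s) - pressure d β h - ε)) *
          Real.exp (-(ε₁ * #(box d N))) := by
        rw [← Real.exp_add, ← Real.exp_add]; congr 1; ring
    _ ≤ Real.exp (-(β * s * (a * #(box d N))) - |β * s| * (δ * #(box d N))) *
          Real.exp (#(box d N) * (pressureIn (zdGraph d) (box d N) β (h + s) bc -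
            pressureIn (zdGraph d) (box d N) β h bc)) *
          (isingMeasure (zdGraph d) (box d N) β (h + s) bc).real
            {σ | |(∑ x ∈ box d N, spinAt x σ) / #(box d N) - a| < δ} :=
        mul_le_mul (mul_le_mul_of_nonneg_left (Real.exp_le_exp.2 (mul_le_mul_of_nonneg_left h1.le hV.le))
          (Real.exp_pos _).le) hN (Real.exp_pos _).le (by positivity)

/-! ### The affine piece of the rate function at `h ≠ 0`: lower and upper bounds on the plateau -/

/-- **LD LOWER BOUND ON THE PLATEAU AT EVERY FIELD** (`d ≥ 1`, `β > 0`): for `|a| ≤ m*(β)`, `δ, ε > 0`, every real `h`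
and every boundary condition, eventually
`exp(−|Λ_N| (ψ(β,h) − ψ(β,0) − βha + |βh|δ + ε)) ≤ μ^{bc}_{Λ_N;β,h}{|M_N/|Λ_N| − a| < δ}` — tilt the zero-field plateau
theorem (`eventually_exp_le_plateau_window`) from the field `0 = h + (−h)` back to `h`.
[cite: Ellis2006, Thm. II.6.1 (c), Thm. V.6.1; Lanford1973, §B; FollmerOrey1988, §3] -/
theorem ld_lower_plateau_field (hd : 1 ≤ d) {β : ℝ} (hβ : 0 < β) (h : ℝ) {a : ℝ}
    (ha : |a| ≤ spontaneousMagnetization d β) {δ : ℝ} (hδ : 0 < δ) {ε : ℝ} (hε : 0 < ε)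
    (bc : BoundaryCondition (Site d)) :
    ∀ᶠ N : ℕ in atTop,
      Real.exp (-(#(box d N) * (pressure d β h - pressure d β 0 - β * h * a + |β * h| * δ + ε))) ≤
        (isingMeasure (zdGraph d) (box d N) β h bc).real {σ | |(∑ x ∈ box d N, spinAt x σ) / #(box d N) - a| < δ} := by
  have hW : ∀ᶠ N : ℕ in atTop, Real.exp (-(ε / 2 * #(box d N))) ≤
      (isingMeasure (zdGraph d) (box d N) β (h + -h) bc).real
        {σ | |(∑ x ∈ box d N, spinAt x σ) / #(box d N) - a| < δ} := by
    rw [add_neg_cancel]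
    exact eventually_exp_le_plateau_window hd hβ ha hδ (half_pos hε) bc
  have h1 := eventually_exp_le_measureReal_window_of_exp_le β h (-h) bc a δ hW (half_pos hε)
  refine h1.mono fun N hN => le_of_eq_of_le ?_ hN
  rw [add_neg_cancel, mul_neg, abs_neg]
  congr 1
  ring

/-- **LD UPPER BOUND ON THE PLATEAU SIDE, `h ≥ 0`** (`β ≥ 0`): for every `a`, `ε > 0` and every `bc`, eventually
`μ^{bc}_{Λ_N;β,h}{M_N ≤ a|Λ_N|} ≤ exp(−|Λ_N| (ψ(β,h) − ψ(β,0) − βha − ε))` (Chernoff with the tilt `s = h`; the sharp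
rate for `a ≤ m*(β)`). [cite: Ellis2006, Thm. II.6.1 (b) with §IV.5 (4.33)] -/
theorem ld_upper_plateau_of_nonneg_field {β h : ℝ} (hβ : 0 ≤ β) (hh : 0 ≤ h) (a : ℝ) {ε : ℝ} (hε : 0 < ε)
    (bc : BoundaryCondition (Site d)) :
    ∀ᶠ N : ℕ in atTop,
      (isingMeasure (zdGraph d) (box d N) β h bc).real {σ | ∑ x ∈ box d N, spinAt x σ ≤ a * #(box d N)} ≤
        Real.exp (-(#(box d N) * (pressure d β h - pressure d β 0 - β * h * a - ε))) := by
  have h1 := eventually_measureReal_sum_spinAt_le_le (d := d) (mul_nonneg hβ hh) h bc a hε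
  refine h1.mono fun N hN => hN.trans_eq ?_
  rw [sub_self]
  congr 1
  ring

/-- **LD UPPER BOUND ON THE PLATEAU SIDE, `h ≤ 0`** (`β ≥ 0`): eventually
`μ^{bc}_{Λ_N;β,h}{a|Λ_N| ≤ M_N} ≤ exp(−|Λ_N| (ψ(β,h) − ψ(β,0) − βha − ε))` (tilt `s = −h`).
[cite: Ellis2006, Thm. II.6.1 (b) with §IV.5 (4.33)] -/
theorem ld_upper_plateau_of_nonpos_field {β h : ℝ} (hβ : 0 ≤ β) (hh : h ≤ 0) (a : ℝ) {ε : ℝ} (hε : 0 < ε)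
    (bc : BoundaryCondition (Site d)) :
    ∀ᶠ N : ℕ in atTop,
      (isingMeasure (zdGraph d) (box d N) β h bc).real {σ | a * #(box d N) ≤ ∑ x ∈ box d N, spinAt x σ} ≤
        Real.exp (-(#(box d N) * (pressure d β h - pressure d β 0 - β * h * a - ε))) := by
  have h1 := eventually_measureReal_le_sum_spinAt_le (d := d) (β := β) (s := -h) (by nlinarith) h bc a hε
  refine h1.mono fun N hN => hN.trans_eq ?_
  rw [add_neg_cancel]
  congr 1
  ring

/-- **ON THE PLATEAU THE LEGENDRE TRANSFORM IS THE AFFINE FUNCTION `ψ(h) − ψ(0) − βha`** (`d ≥ 1`, `β ≥ 0`,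
`|a| ≤ m*(β)`): `βua − (ψ(β,h+u) − ψ(β,h)) ≤ ψ(β,h) − ψ(β,0) − βha` for every `u`, with equality at `u = −h`
(the Maxwell line: the rate function of the magnetisation at field `h` is affine on the coexistence segment).
[cite: Ellis2006, (2.28), §IV.5 (4.34) and Thm. V.6.1 (d)–(e); FriedliVelenik2017, §4.7] -/
theorem rate_field_le_affine_of_abs_le_spontaneousMagnetization (hd : 1 ≤ d) {β : ℝ} (hβ : 0 ≤ β) (h : ℝ) {a : ℝ}
    (ha : |a| ≤ spontaneousMagnetization d β) (u : ℝ) :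
    β * u * a - (pressure d β (h + u) - pressure d β h) ≤ pressure d β h - pressure d β 0 - β * h * a := by
  have := rate_nonpos_zero_field_of_abs_le_spontaneousMagnetization hd hβ ha (h + u)
  nlinarith

/-- The affine value is attained by the Legendre functional at `u = −h`. [cite: Ellis2006, (2.28)] -/
theorem rate_field_affine_eq (β h a : ℝ) :
    β * (-h) * a - (pressure d β (h + -h) - pressure d β h) = pressure d β h - pressure d β 0 - β * h * a := by
  rw [add_neg_cancel]; ring

/-- **THE AFFINE RATE IS POSITIVE OFF `h = 0`** (`d ≥ 1`, `β > 0`, `h ≠ 0`, `|a| ≤ m*(β)`):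
`0 < ψ(β,h) − ψ(β,0) − βha` (trapezoid bound `βh(m* + m(β,h))/2 ≤ ψ(h) − ψ(0)` and `m(β,h) > m*` for `h > 0`;
evenness of `ψ(β,·)` for `h < 0`). Hence at `h ≠ 0` every plateau density is exponentially unlikely, at an affine
rate. [cite: Ellis2006, Thm. V.6.1 (c); FriedliVelenik2017, Thm. 3.43 and Exercise 3.18] -/
theorem affine_rate_pos_of_field_ne_zero (hd : 1 ≤ d) {β : ℝ} (hβ : 0 < β) {h : ℝ} (hh : h ≠ 0) {a : ℝ}
    (ha : |a| ≤ spontaneousMagnetization d β) :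
    0 < pressure d β h - pressure d β 0 - β * h * a := by
  -- the case `h > 0`, for every `a` with `|a| ≤ m*`
  have key : ∀ {k b : ℝ}, 0 < k → |b| ≤ spontaneousMagnetization d β →
      0 < pressure d β k - pressure d β 0 - β * k * b := by
    intro k b hk hb
    have htz := IsingPressure.trapezoid_le_pressure_sub_pressure_zero (d := d) hd hβ.le hk.le
    have hmk : spontaneousMagnetization d β < magnetizationInField d β k := by
      rw [← magnetizationInField_zero]
      exact IsingSusceptibility.strictMonoOn_magnetizationInField (d := d) hβ (mem_Ici.2 le_rfl) (mem_Ici.2 hk.le) hk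
    have hb' : b ≤ spontaneousMagnetization d β := (le_abs_self b).trans hb
    have hβk : 0 < β * k := mul_pos hβ hk
    nlinarith
  rcases lt_or_gt_of_ne hh with hneg | hpos
  · have h1 := key (k := -h) (b := -a) (neg_pos.2 hneg) (by rwa [abs_neg])
    rw [IsingSusceptibility.pressure_neg_field] at h1
    linarith
  · exact key hpos ha

/-- **TWO-SIDED WINDOW ASYMPTOTICS ON THE PLATEAU AT `h > 0`**: for `|a| ≤ m*(β)`, `δ, ε > 0`, every `bc`, eventually
`exp(−|Λ_N|(I + βhδ + ε)) ≤ μ^{bc}_{Λ_N;β,h}{|M_N/|Λ_N| − a| < δ} ≤ exp(−|Λ_N|(I − βhδ − ε))` with the affine rate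
`I = ψ(β,h) − ψ(β,0) − βha` (the window lies in the half-line `{M_N < (a + δ)|Λ_N|}`).
[cite: Ellis2006, Thm. II.6.1, Thm. V.6.1 (c); FollmerOrey1988, §3] -/
theorem plateau_window_mem_Icc_pos_field (hd : 1 ≤ d) {β : ℝ} (hβ : 0 < β) {h : ℝ} (hh : 0 < h) {a : ℝ}
    (ha : |a| ≤ spontaneousMagnetization d β) {δ : ℝ} (hδ : 0 < δ) {ε : ℝ} (hε : 0 < ε)
    (bc : BoundaryCondition (Site d)) :
    ∀ᶠ N : ℕ in atTop,
      (isingMeasure (zdGraph d) (box d N) β h bc).real {σ | |(∑ x ∈ box d N, spinAt x σ) / #(box d N) - a| < δ} ∈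
        Icc (Real.exp (-(#(box d N) * (pressure d β h - pressure d β 0 - β * h * a + β * h * δ + ε))))
          (Real.exp (-(#(box d N) * (pressure d β h - pressure d β 0 - β * h * a - β * h * δ - ε)))) := by
  have hβh : |β * h| = β * h := abs_of_pos (mul_pos hβ hh)
  filter_upwards [ld_lower_plateau_field hd hβ h ha hδ hε bc,
    ld_upper_plateau_of_nonneg_field (d := d) hβ.le hh.le (a + δ) hε bc] with N h1 h2
  rw [hβh] at h1
  refine ⟨h1, ?_⟩
  have hΛ := box_nonempty d N
  have hV : (0 : ℝ) < #(box d N) := by exact_mod_cast hΛ.card_pos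
  have hsub : {σ : SpinConfig (Site d) | |(∑ x ∈ box d N, spinAt x σ) / #(box d N) - a| < δ} ⊆
      {σ | ∑ x ∈ box d N, spinAt x σ ≤ (a + δ) * #(box d N)} := by
    intro σ hσ
    simp only [mem_setOf_eq] at hσ ⊢
    rw [setOf_abs_div_sub_lt_eq' hV, abs_lt] at hσ
    linarith [hσ.2]
  refine (measureReal_mono hsub).trans (h2.trans_eq ?_)
  congr 1
  ring

/-! ### The LDP at every density `|a| < 1`: the Legendre rate is attained and the lower bound holds -/

/-- **THE LEVEL-1 LDP OF THE MAGNETISATION AT EVERY `(β, h)`, EVERY BOUNDARY CONDITION, EVERY DENSITY** (`d ≥ 1`,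
`β > 0`): for every real `h`, every `a` with `|a| < 1`, all `δ, ε > 0` and every `bc` there is a field increment `s`
such that, with `I = βsa − (ψ(β,h+s) − ψ(β,h))`:
(i) `βua − (ψ(β,h+u) − ψ(β,h)) ≤ I` for EVERY real `u` — the Legendre supremum defining the rate function at `a` is
ATTAINED at `s` (for `|a| ≤ m*`: `s = −h`; for `m* < |a| < 1`: `h + s` is the exposing field, `ψ'(β,·)(h+s) = βa`);
(ii) LOWER BOUND: eventually `exp(−|Λ_N|(I + |βs|δ + ε)) ≤ μ^{bc}_{Λ_N;β,h}{|M_N/|Λ_N| − a| < δ}`;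
(iii) UPPER BOUND on the far half-line: if `s ≥ 0`, eventually `μ{a|Λ_N| ≤ M_N} ≤ exp(−|Λ_N|(I − ε))`; if `s ≤ 0`,
eventually `μ{M_N ≤ a|Λ_N|} ≤ exp(−|Λ_N|(I − ε))`.
[cite: Ellis2006, Thm. II.6.1, (2.28), §IV.5 (4.33)–(4.34), Thm. V.6.1; Lanford1973, §A4–§B; FollmerOrey1988, Thm. 3.1] -/
theorem exists_rate_attained_and_ld_bounds (hd : 1 ≤ d) {β : ℝ} (hβ : 0 < β) (h : ℝ) {a : ℝ} (ha : |a| < 1)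
    {δ : ℝ} (hδ : 0 < δ) {ε : ℝ} (hε : 0 < ε) (bc : BoundaryCondition (Site d)) :
    ∃ s : ℝ,
      (∀ u : ℝ, β * u * a - (pressure d β (h + u) - pressure d β h) ≤
        β * s * a - (pressure d β (h + s) - pressure d β h)) ∧
      (∀ᶠ N : ℕ in atTop,
        Real.exp (-(#(box d N) * (β * s * a - (pressure d β (h + s) - pressure d β h) + |β * s| * δ + ε))) ≤
          (isingMeasure (zdGraph d) (box d N) β h bc).real
            {σ | |(∑ x ∈ box d N, spinAt x σ) / #(box d N) - a| < δ}) ∧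
      (0 ≤ s → ∀ᶠ N : ℕ in atTop,
        (isingMeasure (zdGraph d) (box d N) β h bc).real {σ | a * #(box d N) ≤ ∑ x ∈ box d N, spinAt x σ} ≤
          Real.exp (-(#(box d N) * (β * s * a - (pressure d β (h + s) - pressure d β h) - ε)))) ∧
      (s ≤ 0 → ∀ᶠ N : ℕ in atTop,
        (isingMeasure (zdGraph d) (box d N) β h bc).real {σ | ∑ x ∈ box d N, spinAt x σ ≤ a * #(box d N)} ≤
          Real.exp (-(#(box d N) * (β * s * a - (pressure d β (h + s) - pressure d β h) - ε)))) := by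
  -- the two Chernoff half-line bounds, valid for EVERY `s` of the right sign
  have hup : ∀ s : ℝ, 0 ≤ s → ∀ᶠ N : ℕ in atTop,
      (isingMeasure (zdGraph d) (box d N) β h bc).real {σ | a * #(box d N) ≤ ∑ x ∈ box d N, spinAt x σ} ≤
        Real.exp (-(#(box d N) * (β * s * a - (pressure d β (h + s) - pressure d β h) - ε))) := fun s hs =>
    eventually_measureReal_le_sum_spinAt_le (d := d) (mul_nonneg hβ.le hs) h bc a hε
  have hlow : ∀ s : ℝ, s ≤ 0 → ∀ᶠ N : ℕ in atTop,
      (isingMeasure (zdGraph d) (box d N) β h bc).real {σ | ∑ x ∈ box d N, spinAt x σ ≤ a * #(box d N)} ≤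
        Real.exp (-(#(box d N) * (β * s * a - (pressure d β (h + s) - pressure d β h) - ε))) := by
    intro s hs
    have h1 := eventually_measureReal_sum_spinAt_le_le (d := d) (β := β) (s := -s) (by nlinarith) h bc a hε
    refine h1.mono fun N hN => hN.trans_eq ?_
    rw [sub_neg_eq_add]
    congr 1
    ring
  by_cases hpl : |a| ≤ spontaneousMagnetization d β
  · -- the plateau: `s = −h`
    refine ⟨-h, fun u => ?_, ?_, hup (-h), hlow (-h)⟩
    · rw [rate_field_affine_eq]
      exact rate_field_le_affine_of_abs_le_spontaneousMagnetization hd hβ.le h hpl u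
    · have h1 := ld_lower_plateau_field hd hβ h hpl hδ hε bc
      refine h1.mono fun N hN => le_of_eq_of_le ?_ hN
      rw [rate_field_affine_eq, mul_neg, abs_neg]
  · -- an exposed density: `h + s = ±k` with `m(β,k) = |a|`
    rw [not_le] at hpl
    have hD : ∃ k : ℝ, HasDerivAt (fun t => pressure d β t) (β * a) k := by
      rcases le_or_gt 0 a with ha0 | ha0
      · rw [abs_of_nonneg ha0] at ha hpl
        obtain ⟨k, hk, hka⟩ := exists_pos_field_magnetizationInField_eq (d := d) hβ hpl ha
        exact ⟨k, hka ▸ IsingSusceptibility.hasDerivAt_pressure_field hd hβ.le hk⟩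
      · rw [abs_of_neg ha0] at ha hpl
        obtain ⟨k, hk, hka⟩ := exists_pos_field_magnetizationInField_eq (d := d) hβ hpl ha
        refine ⟨-k, ?_⟩
        have := IsingSusceptibility.hasDerivAt_pressure_field_of_neg hd hβ.le (neg_neg_of_pos hk)
        rw [neg_neg, hka, mul_neg, neg_neg] at this
        exact this
    obtain ⟨k, hk⟩ := hD
    refine ⟨k - h, fun u => ?_, ?_, hup (k - h), hlow (k - h)⟩
    · have hk' : HasDerivAt (fun t => pressure d β t) (β * a) (h + (k - h)) := by rwa [add_sub_cancel]
      exact rate_le_rate_of_hasDerivAt (d := d) hk' u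
    · have hk' : HasDerivAt (fun t => pressure d β t) (β * a) (h + (k - h)) := by rwa [add_sub_cancel]
      have h1 := ld_lower_bound_of_hasDerivAt hd hβ hk' hδ hε bc
      refine h1.mono fun N hN => le_of_eq_of_le ?_ (hN.trans_eq ?_)
      · congr 2; ring
      · rw [mul_div_cancel_left₀ _ hβ.ne']

/-- **THE ZERO-FIELD LDP AT EVERY DENSITY, EVERY BOUNDARY CONDITION** (`h = 0`): for `|a| < 1` there is an exposing
field `s` (`s = 0` on the plateau `|a| ≤ m*`) with `βua − (ψ(β,u) − ψ(β,0)) ≤ I := βsa − (ψ(β,s) − ψ(β,0))` for all `u`,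
and eventually `exp(−|Λ_N|(I + |βs|δ + ε)) ≤ μ^{bc}_{Λ_N;β,0}{|M_N/|Λ_N| − a| < δ}`; with the half-line upper bounds of
`exists_rate_attained_and_ld_bounds`. [cite: Ellis2006, Thm. II.6.1 and Thm. V.6.1; Lanford1973, §A4] -/
theorem ld_bounds_zero_field (hd : 1 ≤ d) {β : ℝ} (hβ : 0 < β) {a : ℝ} (ha : |a| < 1) {δ : ℝ} (hδ : 0 < δ)
    {ε : ℝ} (hε : 0 < ε) (bc : BoundaryCondition (Site d)) :
    ∃ s : ℝ,
      (∀ u : ℝ, β * u * a - (pressure d β u - pressure d β 0) ≤ β * s * a - (pressure d β s - pressure d β 0)) ∧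
      (∀ᶠ N : ℕ in atTop,
        Real.exp (-(#(box d N) * (β * s * a - (pressure d β s - pressure d β 0) + |β * s| * δ + ε))) ≤
          (isingMeasure (zdGraph d) (box d N) β 0 bc).real
            {σ | |(∑ x ∈ box d N, spinAt x σ) / #(box d N) - a| < δ}) := by
  obtain ⟨s, h1, h2, -, -⟩ := exists_rate_attained_and_ld_bounds hd hβ 0 ha hδ hε bc
  simp only [zero_add] at h1 h2
  exact ⟨s, h1, h2⟩

end IsingLargeDeviations

end Summit.CriticalPhenomena.PercolationContinuityZ3.Theorems.FK
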